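import Literature.Geometry.Kaehler.ComplexTorusLatticeSpInvariantPairings
import HarnessLib

/-!
# Borel density for pairings: every `Γ_D(n)`-invariant bilinear pairing `Hᵏ(X, ℂ) × Hˡ(X, ℂ) → ℂ` (`k ≤ g`) is
# `Sp(V, η)(ℝ)`-invariant — hence `0` for `k + l` odd and `Σ_r c_r Q_k(Lʲ π_{l,r} y, x)` for `l = k - 2j`

Layer `Literature/Geometry/Kaehler`, namespace `Literature.Geometry.Kaehler.ComplexTorus`; lane `lit-hodgefound`
(Track 2 foundations library), seat p09, generation 26, row g26-#9. THEOREMS ONLY (no definition, no named fact).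
Sequel of g26-#8 `ComplexTorusLatticeSpInvariantPairings` (the `Sp(E, η)`-invariant pairings between cohomology
groups of the complex torus `X = E/Φ(ℤ^ι)`: `P(x, y) = Q_k(Ay, x)` with `A` equivariant; parity vanishing;
`P(x, y) = Σ_r c_r Q_k(Lʲ π_{l,r} y, x)` for `l + 2j = k ≤ g`) and of g25-#1 `ComplexTorusLatticeSpDensity` (Borel
density (B): a `ℂ`-linear map `Hᵏ → Hᵏ'` commuting with the level-`n` arithmetic subgroup `Γ_D(n)` of the integral
symplectic group `Sp(Λ, η)`, `η ∈ NS(X)` non-degenerate, commutes with all of `Sp(V, η)(ℝ)`,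
`IsNSForm.sp_equivariant_of_levelSp_equivariant`). For pairings: the operator `A` of a `Γ_D(n)`-invariant pairing
commutes with `Γ_D(n)` (Lemma 4.3.2 mechanism — `Q_k` is invariant and pull-back is injective), hence with
`Sp(V, η)(ℝ)`, hence the pairing is `Sp(V, η)(ℝ)`-invariant and g26-#8 applies.

## The sources, verbatim

* G. A. Margulis, *Discrete Subgroups of Semisimple Lie Groups* (1991), Chap. I Prop. (3.2.11) (Borel density), as
  used in g25-#1; H. Lange (2023) §3.1.3 (3.7)–(3.8) (`Γ_D`, `Γ_D(n)`).
* R. Goodman, N. R. Wallach (GTM 255), §4.3.2 Lemma 4.3.2 (held chunk p0304): "`Hom_G(V ⊗ W, ℂ) ≅ Hom_G(W, V*)`";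
  §5.5.1 Lemma 5.5.4 (p. 383): "the space `Hom_G(V^{⊗l}, V^{⊗k})` is zero if `k + l` is odd"; Thm. 5.5.8.
* J. S. Milne, *Lefschetz classes on abelian varieties* (1999), §5 Prop. 5.4 (proof), pp. 664–665.

## Contents (theorems only; no `sorry`, no new definition, net debt 0)

* **`IsNSForm.sp_invariant_pairing_of_levelSp_invariant`** — a `Γ_D(n)`-invariant pairing `Hᵏ(X, ℂ) × Hˡ(X, ℂ) → ℂ`
  (`k ≤ g`, any `l`) is `Sp(V, η)(ℝ)`-invariant.
* **`IsNSForm.eq_zero_of_levelSp_invariant_pairing_of_odd`** — it vanishes for `k + l` odd (`l ≤ 2g`).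
* **`IsNSForm.exists_eq_sum_mul_of_levelSp_invariant_pairing`** — for `l + 2j = k ≤ g` it is
  `Σ_{r ∈ lefschetzRange g l} c_r Q_k(Lʲ π_{l,r} y, x)`; and the full-group case
  `IsNSForm.exists_eq_sum_mul_of_latticeSp_invariant_pairing` (`Sp(Λ, η)`, `n = 1`).

## References

* [cite: Margulis1991, Chap. I Prop. (3.2.11)]
* [cite: GoodmanWallachGTM255, §4.3.2 Lemma 4.3.2 (chunk p0304); §5.5.1 Lemma 5.5.4, Thm. 5.5.8 (pp. 383–384)]
* [cite: Lange2023AbelianVarietiesComplex, §3.1.3 (3.7)–(3.8); §7.3.2 (1)–(3) (p. 338)]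
* [cite: Milne1999LefschetzClasses, §5 Prop. 5.4 (proof), pp. 664–665]
-/

noncomputable section

open Module Complex

namespace Literature.Geometry.Kaehler.ComplexTorus

section Arithmetic

variable {ι : Type*} [Fintype ι] [DecidableEq ι] {E : Type*} [NormedAddCommGroup E] [NormedSpace ℂ E]
  [FiniteDimensional ℂ E] (Φ : (ι → ℝ) ≃L[ℝ] E) {η : E [⋀^Fin 2]→L[ℝ] ℝ}

omit [Fintype ι] [DecidableEq ι] [FiniteDimensional ℂ E] in
/-- The two phrasings of non-degeneracy. [folklore] -/
private theorem nondegenerate_of_forall (hnd : ∀ u : E, (∀ v : E, η ![u, v] = 0) → u = 0) :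
    ∀ v : E, v ≠ 0 → ∃ w : E, η ![v, w] ≠ 0 :=
  fun v hv ↦ not_forall.mp fun h ↦ hv (hnd v h)

/-- **BOREL DENSITY FOR PAIRINGS: a `Γ_D(n)`-invariant bilinear pairing `P : Hᵏ(X, ℂ) × Hˡ(X, ℂ) → ℂ` (`X = E/Λ`,
`η ∈ NS(X)` non-degenerate, `n ≥ 1`, `k ≤ g`) is invariant under the whole real symplectic group `Sp(V, η)(ℝ)`** —
`P(x, y) = Q_k(Ay, x)` with `A` commuting with `Γ_D(n)` (Lemma 4.3.2 mechanism: `Q_k` is invariant and pull-back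
along `Γ_D(n)` is injective on `Hᵏ`), hence with `Sp(V, η)(ℝ)` by Borel density (g25-#1), and then `P(x∘M, y∘M)
= Q_k((Ay)∘M, x∘M) = P(x, y)`. [cite: Margulis1991, Chap. I Prop. (3.2.11)] [cite: GoodmanWallachGTM255, §4.3.2 Lemma 4.3.2]
[cite: Lange2023AbelianVarietiesComplex, §3.1.3 (3.7)–(3.8)] -/
theorem IsNSForm.sp_invariant_pairing_of_levelSp_invariant
    (hη : IsNSForm Φ η) (hnd : ∀ u : E, (∀ v : E, η ![u, v] = 0) → u = 0) (n : ℕ) [NeZero n]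
    {g : ℕ} (e : Fin (2 * g) ≃ ι) {k r₀ : ℕ} (hkr : k + r₀ = g) {l : ℕ}
    (P : (E [⋀^Fin k]→L[ℝ] ℂ) →ₗ[ℂ] (E [⋀^Fin l]→L[ℝ] ℂ) →ₗ[ℂ] ℂ)
    (hP : ∀ T : E →L[ℝ] E, (∀ u v : E, η ![T u, T v] = η ![u, v]) →
      (∀ m : ι → ℤ, ∃ m' : ι → ℤ, T (latticeVec Φ m) = latticeVec Φ (m + (n : ℤ) • m')) →
      ∀ (x : E [⋀^Fin k]→L[ℝ] ℂ) (y : E [⋀^Fin l]→L[ℝ] ℂ),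
        P (x.compContinuousLinearMap T) (y.compContinuousLinearMap T) = P x y)
    {M : E →L[ℝ] E} (hM : ∀ u v : E, η ![M u, M v] = η ![u, v]) (x : E [⋀^Fin k]→L[ℝ] ℂ)
    (y : E [⋀^Fin l]→L[ℝ] ℂ) :
    P (x.compContinuousLinearMap M) (y.compContinuousLinearMap M) = P x y := by
  have hg : finrank ℂ E = g := finrank_eq_of_finTwoMulEquiv Φ e
  have hnd' := nondegenerate_of_forall hnd
  haveI : FiniteDimensional ℂ (E [⋀^Fin k]→L[ℝ] ℂ) := finiteDimensional_alt_of_le (by omega)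
  have hQ := lefschetzIntersectionForm_nondegenerate Φ hnd e hkr
  obtain ⟨A, hA⟩ := exists_forall_eq_apply_of_nondegenerate_pairing P hQ
  -- `A` commutes with `Γ_D(n)`
  have hAT : ∀ T : E →L[ℝ] E, (∀ u v : E, η ![T u, T v] = η ![u, v]) →
      (∀ m : ι → ℤ, ∃ m' : ι → ℤ, T (latticeVec Φ m) = latticeVec Φ (m + (n : ℤ) • m')) →
      ∀ w : E [⋀^Fin l]→L[ℝ] ℂ, A (w.compContinuousLinearMap T) = (A w).compContinuousLinearMap T := by
    intro T hT hTΛ w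
    let ρ : (E [⋀^Fin k]→L[ℝ] ℂ) →ₗ[ℂ] (E [⋀^Fin k]→L[ℝ] ℂ) :=
      { toFun := fun w ↦ w.compContinuousLinearMap T
        map_add' := fun x y ↦ by ext v; rfl
        map_smul' := fun c x ↦ by ext v; rfl }
    let σ : (E [⋀^Fin l]→L[ℝ] ℂ) →ₗ[ℂ] (E [⋀^Fin l]→L[ℝ] ℂ) :=
      { toFun := fun w ↦ w.compContinuousLinearMap T
        map_add' := fun x y ↦ by ext v; rfl
        map_smul' := fun c x ↦ by ext v; rfl }
    have hρ : ∀ w, ρ w = w.compContinuousLinearMap T := fun _ ↦ rfl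
    have hσ : ∀ w, σ w = w.compContinuousLinearMap T := fun _ ↦ rfl
    have h := apply_comm_of_pairing_invariant hQ hA (ρ := ρ) (σ := σ)
      (compContinuousLinearMap_injective_of_preserves hnd' hT k)
      (fun x y ↦ lefschetzIntersectionForm_compContinuousLinearMap Φ hnd e hkr hT x y) (hP T hT hTΛ) w
    rwa [hρ, hσ] at h
  -- hence with `Sp(V, η)(ℝ)` (Borel density)
  have hAM := hη.sp_equivariant_of_levelSp_equivariant hnd n A hAT M hM y
  rw [hA, hA, hAM, lefschetzIntersectionForm_compContinuousLinearMap Φ hnd e hkr hM]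

include Φ in
/-- **No non-zero `Γ_D(n)`-invariant pairing `Hᵏ(X, ℂ) × Hˡ(X, ℂ) → ℂ` for `k + l` odd** (`k ≤ g`, `l ≤ 2g`):
Borel density and the parity vanishing of the `Sp(E, η)`-invariant pairings (Lemma 5.5.4).
[cite: GoodmanWallachGTM255, §5.5.1 Lemma 5.5.4; §4.3.2 Lemma 4.3.2] [cite: Margulis1991, Chap. I Prop. (3.2.11)] -/
theorem IsNSForm.eq_zero_of_levelSp_invariant_pairing_of_odd
    (hη : IsNSForm Φ η) (hnd : ∀ u : E, (∀ v : E, η ![u, v] = 0) → u = 0) (n : ℕ) [NeZero n]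
    {g : ℕ} (e : Fin (2 * g) ≃ ι) {k r₀ : ℕ} (hkr : k + r₀ = g) {l : ℕ} (hl : l ≤ 2 * g) (hodd : Odd (k + l))
    (P : (E [⋀^Fin k]→L[ℝ] ℂ) →ₗ[ℂ] (E [⋀^Fin l]→L[ℝ] ℂ) →ₗ[ℂ] ℂ)
    (hP : ∀ T : E →L[ℝ] E, (∀ u v : E, η ![T u, T v] = η ![u, v]) →
      (∀ m : ι → ℤ, ∃ m' : ι → ℤ, T (latticeVec Φ m) = latticeVec Φ (m + (n : ℤ) • m')) →
      ∀ (x : E [⋀^Fin k]→L[ℝ] ℂ) (y : E [⋀^Fin l]→L[ℝ] ℂ),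
        P (x.compContinuousLinearMap T) (y.compContinuousLinearMap T) = P x y) :
    P = 0 :=
  eq_zero_of_sp_invariant_pairing_of_odd Φ hnd e hkr hl hodd P
    fun _ hM x y ↦ hη.sp_invariant_pairing_of_levelSp_invariant Φ hnd n e hkr P hP hM x y

/-- **THE `Γ_D(n)`-INVARIANT PAIRINGS `Hᵏ(X, ℂ) × Hˡ(X, ℂ) → ℂ`, `l + 2j = k ≤ g`**: each is
`P(x, y) = Σ_{r ∈ lefschetzRange g l} c_r Q_k(Lʲ π_{l,r} y, x)` (Borel density, then Thm. 5.5.8 through g26-#8).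
[cite: GoodmanWallachGTM255, §4.3.2 Lemma 4.3.2; §5.5.1 Thm. 5.5.8] [cite: Margulis1991, Chap. I Prop. (3.2.11)]
[cite: Milne1999LefschetzClasses, §5 pp. 664–665] -/
theorem IsNSForm.exists_eq_sum_mul_of_levelSp_invariant_pairing
    (hη : IsNSForm Φ η) (hnd : ∀ u : E, (∀ v : E, η ![u, v] = 0) → u = 0) (n : ℕ) [NeZero n]
    {g : ℕ} (e : Fin (2 * g) ≃ ι) {k r₀ : ℕ} (hkr : k + r₀ = g) {l j : ℕ} (hj : 2 * j + l = k)
    (P : (E [⋀^Fin k]→L[ℝ] ℂ) →ₗ[ℂ] (E [⋀^Fin l]→L[ℝ] ℂ) →ₗ[ℂ] ℂ)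
    (hP : ∀ T : E →L[ℝ] E, (∀ u v : E, η ![T u, T v] = η ![u, v]) →
      (∀ m : ι → ℤ, ∃ m' : ι → ℤ, T (latticeVec Φ m) = latticeVec Φ (m + (n : ℤ) • m')) →
      ∀ (x : E [⋀^Fin k]→L[ℝ] ℂ) (y : E [⋀^Fin l]→L[ℝ] ℂ),
        P (x.compContinuousLinearMap T) (y.compContinuousLinearMap T) = P x y) :
    ∃ c : ℕ → ℂ, ∀ (x : E [⋀^Fin k]→L[ℝ] ℂ) (y : E [⋀^Fin l]→L[ℝ] ℂ), P x y =
      ∑ r ∈ lefschetzRange g l, c r *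
        lefschetzIntersectionForm Φ η e hkr (lefschetzPow η j hj (primitiveProj η l r y)) x :=
  exists_eq_sum_mul_lefschetzIntersectionForm_lefschetzPow_primitiveProj_of_sp_invariant_pairing Φ hnd e hkr hj P
    fun _ hM x y ↦ hη.sp_invariant_pairing_of_levelSp_invariant Φ hnd n e hkr P hP hM x y

/-- **The full integral symplectic group `Sp(Λ, η)`** (`n = 1`): an `Sp(Λ, η)`-invariant pairing
`Hᵏ(X, ℂ) × Hˡ(X, ℂ) → ℂ`, `l + 2j = k ≤ g`, is `Σ_{r ∈ lefschetzRange g l} c_r Q_k(Lʲ π_{l,r} y, x)`.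
[cite: GoodmanWallachGTM255, §4.3.2 Lemma 4.3.2; §5.5.1 Thm. 5.5.8] [cite: Margulis1991, Chap. I Prop. (3.2.11)] -/
theorem IsNSForm.exists_eq_sum_mul_of_latticeSp_invariant_pairing
    (hη : IsNSForm Φ η) (hnd : ∀ u : E, (∀ v : E, η ![u, v] = 0) → u = 0)
    {g : ℕ} (e : Fin (2 * g) ≃ ι) {k r₀ : ℕ} (hkr : k + r₀ = g) {l j : ℕ} (hj : 2 * j + l = k)
    (P : (E [⋀^Fin k]→L[ℝ] ℂ) →ₗ[ℂ] (E [⋀^Fin l]→L[ℝ] ℂ) →ₗ[ℂ] ℂ)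
    (hP : ∀ T : E →L[ℝ] E, (∀ u v : E, η ![T u, T v] = η ![u, v]) →
      (∀ m : ι → ℤ, ∃ m' : ι → ℤ, T (latticeVec Φ m) = latticeVec Φ m') →
      ∀ (x : E [⋀^Fin k]→L[ℝ] ℂ) (y : E [⋀^Fin l]→L[ℝ] ℂ),
        P (x.compContinuousLinearMap T) (y.compContinuousLinearMap T) = P x y) :
    ∃ c : ℕ → ℂ, ∀ (x : E [⋀^Fin k]→L[ℝ] ℂ) (y : E [⋀^Fin l]→L[ℝ] ℂ), P x y =
      ∑ r ∈ lefschetzRange g l, c r *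
        lefschetzIntersectionForm Φ η e hkr (lefschetzPow η j hj (primitiveProj η l r y)) x :=
  hη.exists_eq_sum_mul_of_levelSp_invariant_pairing Φ hnd 1 e hkr hj P fun T hT hTΛ ↦ hP T hT fun m ↦ by
    obtain ⟨m', hm'⟩ := hTΛ m
    exact ⟨_, hm'⟩

end Arithmetic

end Literature.Geometry.Kaehler.ComplexTorus
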